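import Literature.MathematicalPhysics.QuantumFieldTheory.Balaban1983to89.Node00.N24NodesStage13PointedAtLive
import Literature.MathematicalPhysics.QuantumFieldTheory.Balaban1983to89.Node00.N24NodesStage13FourPinPointed

/-!
# NODE N24 · ITEM K1‴'s RUNG BODIES AT STAGE 13 FROM THE POINTED CHILDREN, AND THE LIVE-SELECTOR LINE OVER THE FOUR-PIN VIEW — module 35's recipe at Stage 13:
# N13's 𝐑-half (R₁₃) a THEOREM on the live line (dag-n11-e's `laws₁₃_of_liveSel`), the guard's `SlotsNondegenerate₁₃` a THEOREM at the live re-pin (node00-def-K0a's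
# `slotsNondegenerate₁₃_liveRepin`), `Admissible` ∕ `ZtUnity` transported (`Admissible.liveRepin₁₃`, `ZtUnity.liveRepin₁₃`)

TRACK A (YM-PLAN §2d, node N24 of 28 = binder B2), seat `pub-ymgap-dag-n24-c` (R134 fan-out seat, strategy s2; gen 3).  FORTY-FIRST N24 module, a NEW importing one (imports module 39
`N24NodesStage13PointedAtLive` and module 40 `N24NodesStage13FourPinPointed`).  THEOREMS ONLY, def-free, sorry-free, standard axioms.  Route rev 16: item K1‴ `StabilityBAtRecordR13e`
(stmt-QuantumFields-19910), registered skeleton `K1Skeleton13.lean` (plan g66) with stubs `stub_nodes13 : Inhabited13 F → NodesAtSomeRecord13 F` and `stub_betaWindow13 :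
NodesAtSomeRecord13 F → BetaWindowAtSomeRecord13 F`.

WHAT THIS FILE PROVES (general `N`; N24 is COMPOSITE — every hypothesis list is «which child blocks», nothing is discharged as a node).
§1 THE RUNG BODIES AT THE UNPINNED STAGE-13 VIEW from module 38's pointed children: **`N24_nodesAtSomeRecord₁₃_of_pointed`** (∃-body of `NodesAtSomeRecord13`) and
   **`N24_betaWindowAtSomeRecord₁₃_of_pointed_of_boxH`** (∃-body of `BetaWindowAtSomeRecord13`; β-bounds by module 38's `N24_betaBoundsInInterval_of_isRecordOfRecord₁₃C_of_boxH`, window by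
   module 26's `N24_window_of_betaUpperH`) — witnesses `(θ, hP, w)` themselves; guard `hU` DISPLAYED (K0‴'s product).
§2 THE LIVE LINE OVER THE FOUR-PIN VIEW (module 40 §2 with N13's (R₁₃) discharged): **`N24_stabilityBR13e_thetaShape16_fourPin_pointed_liveSel`** (θ carrying the live-selector clause
   `hsel`, signs `hκ hE₀ hB₀`) and **`N24_stabilityBR13e_thetaShape16_fourPin_pointed_liveRepin₁₃`** (witness `(θ.liveRepin₁₃, hP)`: `SlotsNondegenerate₁₃`, `ZtUnity`, `Admissible`, (R₁₃)
   DISCHARGED BY NAME; `hZ : θ.ZtUnity F N` displayed).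
§3 THE RUNG BODY `BetaWindowAtSomeRecord13` ON THE LIVE RE-PIN, unpinned and four-pin: **`N24_betaWindowAtSomeRecord₁₃_of_pointed_liveRepin₁₃_of_boxH`**,
   **`N24_betaWindowAtSomeRecord₁₃_of_fourPin_pointed_liveRepin₁₃_of_boxH`** — WHICH CHILD BLOCKS `stub_betaWindow13` ON THE LIVE LINE = their hypothesis lists: world consistency at
   `θ.liveRepin₁₃` (`hC hγ hL hup`), N05 [B8] residual leaf, N06 ∕ N07 ∕ N12 leaves (own layers ∕ chosen layers), N08 (leaf systems ∕ THE PRINTED `PrintedUV3V N θ.L`), N09 Lemma-4 leaf +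
   Theorem-3 member, N10 socket, N11 (S1ᵀ), N13 (UV₁₃) only, β-box pair, signs, `hZ`, and `hP : (θ.liveRepin₁₃ F N).Provisos₁₃ F N` (K0a's `provisos₁₃_liveRepin₁₃_of_localBg` line =
   K0‴ 19909's two registered clauses).
HONEST FRAMING: kernel bookkeeping BY NAME; nothing of Bałaban's asserted; no discharge, no count moved (5∕27), no stub closed; one finite T⁴ programme at fixed ε; NOT continuum ∕ ℝ⁴ ∕
OS ∕ mass gap ∕ Clay.
-/

noncomputable section

open scoped Matrix.Norms.L2Operator

namespace Literature.MathematicalPhysics.QuantumFieldTheory.Balaban1983to89.Node00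

open DagBinding T4Continuum T4DatumAssembly FlowStepRuns AveragingRT
open FlowStep (BetaLowerH BetaUpperH)
open B16RLeafRecord13Live (laws₁₃_of_liveSel)

variable {F : T4Family} {N : ℕ} [NeZero N]

/-! ## §1. The rung bodies of K1‴'s registered skeleton at the unpinned Stage-13 view, from the pointed children -/

/-- **THE BODY OF `NodesAtSomeRecord13` FROM THE POINTED CHILDREN, EVERY CHILD BY NAME OR DISPLAYED** (module 38's `N24_nodes₁₃_pointed`; general `N`; guard `hU` DISPLAYED): witnesses
`(θ, hP, w)` themselves.  At `N := 2` the ∃-body of plan g66's `NodesAtSomeRecord13 F`. [cite: Balaban1989LargeFieldII, Thm 1 p.355, (0.1) pp.355–356, p.391; Balaban1987RG1, Thm 3 p.264; Balaban1985Variational, Thm 1 p.279; Balaban1988Convergent, Thm 1 p.262, Cor. 3 (2.50) p.264 (bookkeeping)] -/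
theorem N24_nodesAtSomeRecord₁₃_of_pointed (θ : Stage13Params F N) (hP : θ.Provisos₁₃ F N) (hθ : θ.Admissible F N)
    (hU : θ.ZtUnity F N ∧ θ.SlotsNondegenerate₁₃ F N) (w : WorldP)
    (hC : w.C = (datumOfRecord₁₃ F N θ hP).C) (hγ : 0 < w.γ ∧ w.γ ≤ θ.γ) (hL : w.L = (θ.L : ℝ))
    (hup : ∀ P, w.up P = upOfRecord₅C F N (θ.toStage5₁₃ F N) P)
    (h05 : ∀ P : B12.RunParams,
      B8LeafR (θ.res.X P).d8 (θ.res.X P).L8 (θ.res.X P).C₂ (θ.res.X P).B₁' (θ.res.X P).B₀' (θ.res.X P).B₁ (θ.res.X P).B₂ (θ.res.X P).c₁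
        (θ.res.X P).inp8 (θ.res.X P).B₀β (θ.res.X P).loc8 (θ.res.X P).fam8R (θ.res.X P).lan8 (θ.res.X P).cub8 (θ.res.X P).toAxial8)
    (h06 : ∀ P : B12.RunParams, B9LeafX (θ.res.Y P))
    (h07 : ∀ P : B12.RunParams, B11Leaf (θ.res.Z P))
    (h08 : ∀ P : B12.RunParams, ∃ (Xc : PrintedCarriersR) (I : Type) (C : B10Assembly.Consts) (T : I → B10.TowerRun),
      Nonempty (∀ i, B10Assembly.LeafSystem C (T i)) ∧ θ.res.X P = Xc.withTowerRuns10 T)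
    (h09 : ∀ P : B12.RunParams, B12Sec2to5.Lemma4Printed (θ.res.X P).F12 (θ.res.X P).c12)
    (h09T : ∀ P : B12.RunParams, (leavesP w P).smallCouplings → (leavesP w P).smallFieldInductive)
    (h10 : ∀ P : B12.RunParams, B9LeafX (θ.res.Y P) →
      (B10.Thm1PrintedCompact (θ.res.X P).runs10 ∧ B10.Thm2Printed (θ.res.X P).runs10) →
        B11Leaf (θ.res.Z P) → B12Sec2to5.Lemma4Printed (θ.res.X P).F12 (θ.res.X P).c12 →
          B13.Lemma1Printed (θ.res.X P).S13 (θ.res.X P).c13 ∧ B13.Lemma2Printed (θ.res.X P).S13 (θ.res.X P).c13 ∧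
            B13.Lemma3Printed (θ.res.X P).S13 (θ.res.X P).c13)
    (h11 : ∀ P : B12.RunParams, (leavesP w P).b7 → (leavesP w P).b8 → (leavesP w P).b9 → (leavesP w P).b10 → (leavesP w P).b11 →
      (leavesP w P).smallCouplings → (leavesP w P).smallFieldInductive → (leavesP w P).flowControl →
        ∀ k, k < P.K → SLaw₁₃ F N θ P k → TLaw₁₃ F N θ P k)
    (h12 : ∀ P : B12.RunParams, B15Leaf (θ.res.W P))
    (hR : ∀ (P : B12.RunParams) (k : ℕ), k < P.K → TLaw₁₃ F N θ P k → SLaw₁₃ F N θ P (k + 1))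
    (hUV : ∀ P : B12.RunParams, (genFlow (betaOfRecord₁₃ F N θ) P.g0).InInterval w.γ P.K → ∀ k, k ≤ P.K → SLaw₁₃ F N θ P k →
      ∀ U : GaugeField (F.P P.K) k (SU N),
        chiβOfRecord₁₃ F N θ P.K (gOfRecord₁₃ F N θ P) k U *
              Real.exp (-(1 / (gOfRecord₁₃ F N θ P k) ^ 2 * wilsonBGOfRecord F N θ.εbg P k U)
                - w.em (gOfRecord₁₃ F N θ P k) * (Fintype.card (Site (F.P P.K) k) : ℝ)) ≤ densOfRecord₁₃ F N θ P k U ∧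
        densOfRecord₁₃ F N θ P k U ≤ Real.exp (w.ep (gOfRecord₁₃ F N θ P k) * (Fintype.card (Site (F.P P.K) k) : ℝ))) :
    ∃ (θ' : Stage13Params F N) (h' : θ'.Provisos₁₃ F N) (w' : WorldP), (θ'.ZtUnity F N ∧ θ'.SlotsNondegenerate₁₃ F N) ∧ θ'.Admissible F N ∧
      IsRecordOfRecord₁₃C F N (datumOfRecord₁₃ F N θ' h') w' ∧ ∀ P : B12.RunParams, Nodes (leavesP w' P) := by
  obtain ⟨hrec, hn⟩ := N24_nodes₁₃_pointed θ hP hθ w hC hγ hL hup h05 h06 h07 h08 h09 h09T h10 h11 h12 hR hUV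
  exact ⟨θ, hP, w, hU, hθ, hrec, hn⟩

/-- **THE BODY OF `BetaWindowAtSomeRecord13` FROM THE POINTED CHILDREN AND THE β-BOX PAIR** (module 38's nodes + interval β-binder + module 26's window; guard `hU` DISPLAYED).  At
`N := 2` the ∃-body of plan g66's `BetaWindowAtSomeRecord13 F`. [cite: Balaban1989LargeFieldII, Thm 1 p.355, (0.1) pp.355–356, p.391; Balaban1987RG1, Thm 3 p.264, (0.17)–(0.20) pp.255–256 and (1.22) p.264, (2.9) p.266 (bookkeeping + elementary window)] -/
theorem N24_betaWindowAtSomeRecord₁₃_of_pointed_of_boxH (θ : Stage13Params F N) (hP : θ.Provisos₁₃ F N) (hθ : θ.Admissible F N)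
    (hU : θ.ZtUnity F N ∧ θ.SlotsNondegenerate₁₃ F N) (w : WorldP)
    (hC : w.C = (datumOfRecord₁₃ F N θ hP).C) (hγ : 0 < w.γ ∧ w.γ ≤ θ.γ) (hL : w.L = (θ.L : ℝ))
    (hup : ∀ P, w.up P = upOfRecord₅C F N (θ.toStage5₁₃ F N) P)
    (h05 : ∀ P : B12.RunParams,
      B8LeafR (θ.res.X P).d8 (θ.res.X P).L8 (θ.res.X P).C₂ (θ.res.X P).B₁' (θ.res.X P).B₀' (θ.res.X P).B₁ (θ.res.X P).B₂ (θ.res.X P).c₁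
        (θ.res.X P).inp8 (θ.res.X P).B₀β (θ.res.X P).loc8 (θ.res.X P).fam8R (θ.res.X P).lan8 (θ.res.X P).cub8 (θ.res.X P).toAxial8)
    (h06 : ∀ P : B12.RunParams, B9LeafX (θ.res.Y P))
    (h07 : ∀ P : B12.RunParams, B11Leaf (θ.res.Z P))
    (h08 : ∀ P : B12.RunParams, ∃ (Xc : PrintedCarriersR) (I : Type) (C : B10Assembly.Consts) (T : I → B10.TowerRun),
      Nonempty (∀ i, B10Assembly.LeafSystem C (T i)) ∧ θ.res.X P = Xc.withTowerRuns10 T)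
    (h09 : ∀ P : B12.RunParams, B12Sec2to5.Lemma4Printed (θ.res.X P).F12 (θ.res.X P).c12)
    (h09T : ∀ P : B12.RunParams, (leavesP w P).smallCouplings → (leavesP w P).smallFieldInductive)
    (h10 : ∀ P : B12.RunParams, B9LeafX (θ.res.Y P) →
      (B10.Thm1PrintedCompact (θ.res.X P).runs10 ∧ B10.Thm2Printed (θ.res.X P).runs10) →
        B11Leaf (θ.res.Z P) → B12Sec2to5.Lemma4Printed (θ.res.X P).F12 (θ.res.X P).c12 →
          B13.Lemma1Printed (θ.res.X P).S13 (θ.res.X P).c13 ∧ B13.Lemma2Printed (θ.res.X P).S13 (θ.res.X P).c13 ∧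
            B13.Lemma3Printed (θ.res.X P).S13 (θ.res.X P).c13)
    (h11 : ∀ P : B12.RunParams, (leavesP w P).b7 → (leavesP w P).b8 → (leavesP w P).b9 → (leavesP w P).b10 → (leavesP w P).b11 →
      (leavesP w P).smallCouplings → (leavesP w P).smallFieldInductive → (leavesP w P).flowControl →
        ∀ k, k < P.K → SLaw₁₃ F N θ P k → TLaw₁₃ F N θ P k)
    (h12 : ∀ P : B12.RunParams, B15Leaf (θ.res.W P))
    (hR : ∀ (P : B12.RunParams) (k : ℕ), k < P.K → TLaw₁₃ F N θ P k → SLaw₁₃ F N θ P (k + 1))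
    (hUV : ∀ P : B12.RunParams, (genFlow (betaOfRecord₁₃ F N θ) P.g0).InInterval w.γ P.K → ∀ k, k ≤ P.K → SLaw₁₃ F N θ P k →
      ∀ U : GaugeField (F.P P.K) k (SU N),
        chiβOfRecord₁₃ F N θ P.K (gOfRecord₁₃ F N θ P) k U *
              Real.exp (-(1 / (gOfRecord₁₃ F N θ P k) ^ 2 * wilsonBGOfRecord F N θ.εbg P k U)
                - w.em (gOfRecord₁₃ F N θ P k) * (Fintype.card (Site (F.P P.K) k) : ℝ)) ≤ densOfRecord₁₃ F N θ P k U ∧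
        densOfRecord₁₃ F N θ P k U ≤ Real.exp (w.ep (gOfRecord₁₃ F N θ P k) * (Fintype.card (Site (F.P P.K) k) : ℝ)))
    (hlo : BetaLowerH w.b w.γ (datumOfRecord₁₃ F N θ hP).βfun) (hhi : BetaUpperH w.βup w.γ (datumOfRecord₁₃ F N θ hP).βfun) :
    ∃ (θ' : Stage13Params F N) (h' : θ'.Provisos₁₃ F N) (w' : WorldP), (θ'.ZtUnity F N ∧ θ'.SlotsNondegenerate₁₃ F N) ∧ θ'.Admissible F N ∧
      IsRecordOfRecord₁₃C F N (datumOfRecord₁₃ F N θ' h') w' ∧ (∀ P : B12.RunParams, Nodes (leavesP w' P)) ∧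
      BetaBoundsInInterval w'.C.toB12 w'.γ w'.b w'.βup ∧
      ∃ γ₁ : ℝ, 0 < γ₁ ∧ ∀ γ : ℝ, 0 < γ → γ ≤ γ₁ → ∃ P : B12.RunParams, 1 ≤ P.K ∧ ((datumOfRecord₁₃ F N θ' h').C P).flow.InInterval γ P.K := by
  obtain ⟨hrec, hn⟩ := N24_nodes₁₃_pointed θ hP hθ w hC hγ hL hup h05 h06 h07 h08 h09 h09T h10 h11 h12 hR hUV
  exact ⟨θ, hP, w, hU, hθ, hrec, hn, N24_betaBoundsInInterval_of_isRecordOfRecord₁₃C_of_boxH hrec hlo hhi, N24_window_of_betaUpperH _ hγ.1 hhi⟩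

/-! ## §2. The live-selector line over the four-pin Stage-13 view -/

/-- **ITEM K1‴'s θ-KEYED CONSEQUENT OVER THE FOUR-PIN VIEW ON THE LIVE-SELECTOR LINE** (module 40's `N24_stabilityBR13e_thetaShape16_fourPin_pointed` with N13's (R₁₃) slot
DISCHARGED by dag-n11-e's `laws₁₃_of_liveSel` at a θ carrying the live-selector clause `hsel` and the term-constant signs).  COMPOSITE: nothing is discharged as a node.
[cite: Balaban1989LargeFieldII, Thm 1 p.355, (0.1) pp.355–356, p.391; Balaban1988Convergent, p.244, Thm 2 p.263, (3.16)–(3.22) pp.268–269; Balaban1987RG1, Thm 3 p.264, (0.17)–(0.21) pp.255–256 and (1.22) p.264; Balaban1985UV3, Thm 1 p.257 (bookkeeping + elementary window)] -/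
theorem N24_stabilityBR13e_thetaShape16_fourPin_pointed_liveSel (θ : Stage13Params F N) (hP : θ.Provisos₁₃ F N) (hθ : θ.Admissible F N)
    (hU : θ.ZtUnity F N ∧ θ.SlotsNondegenerate₁₃ F N)
    (hκ : 0 ≤ θ.s2.lf.κ) (hE₀ : 0 ≤ θ.s2.lf.E₀) (hB₀ : 0 ≤ θ.s2.lf.B₀)
    (hsel : θ.ppSel = ppSelLiveOfRecord F N θ.ν θ.τ9 (EOfRecord₁₃ F N θ) (wOfRecord₉ F N θ.toStage9Params)) (Mstar : ℕ) (ops : OpsY N θ.toStage3Params Mstar) (ζ : ResidZ F N) (lamW : ResidW F N)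
    (w : WorldP)
    (hC : w.C = (datumOfRecord₁₃ F N θ hP).C) (hγ : 0 < w.γ ∧ w.γ ≤ θ.γ) (hL : w.L = (θ.L : ℝ))
    (hup : ∀ P, w.up P = upOfRecord₅C F N (θ.view₁₃B10YZW F N Mstar ops ζ lamW) P)
    (h05 : ∀ P : B12.RunParams,
      B8LeafR (θ.res.X P).d8 (θ.res.X P).L8 (θ.res.X P).C₂ (θ.res.X P).B₁' (θ.res.X P).B₀' (θ.res.X P).B₁ (θ.res.X P).B₂ (θ.res.X P).c₁
        (θ.res.X P).inp8 (θ.res.X P).B₀β (θ.res.X P).loc8 (θ.res.X P).fam8R (θ.res.X P).lan8 (θ.res.X P).cub8 (θ.res.X P).toAxial8)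
    (h06 : B9LeafX (Y9OfRecord N θ.toStage3Params Mstar ops))
    (h07 : B11Leaf (Z11OfRecord F N ζ))
    (h08 : PrintedUV3V N θ.L)
    (h09 : ∀ P : B12.RunParams, B12Sec2to5.Lemma4Printed (θ.res.X P).F12 (θ.res.X P).c12)
    (h09T : ∀ P : B12.RunParams, (leavesP w P).smallCouplings → (leavesP w P).smallFieldInductive)
    (h10 : ∀ P : B12.RunParams, B9LeafX (Y9OfRecord N θ.toStage3Params Mstar ops) →
      (B10.Thm1PrintedCompact ((θ.view₁₃B10YZW F N Mstar ops ζ lamW).res.X P).runs10 ∧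
          B10.Thm2Printed ((θ.view₁₃B10YZW F N Mstar ops ζ lamW).res.X P).runs10) →
        B11Leaf (Z11OfRecord F N ζ) → B12Sec2to5.Lemma4Printed (θ.res.X P).F12 (θ.res.X P).c12 →
          B13.Lemma1Printed (θ.res.X P).S13 (θ.res.X P).c13 ∧ B13.Lemma2Printed (θ.res.X P).S13 (θ.res.X P).c13 ∧
            B13.Lemma3Printed (θ.res.X P).S13 (θ.res.X P).c13)
    (h11 : ∀ P : B12.RunParams, (leavesP w P).b7 → (leavesP w P).b8 → (leavesP w P).b9 → (leavesP w P).b10 → (leavesP w P).b11 →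
      (leavesP w P).smallCouplings → (leavesP w P).smallFieldInductive → (leavesP w P).flowControl →
        ∀ k, k < P.K → SLaw₁₃ F N θ P k → TLaw₁₃ F N θ P k)
    (h12 : ∀ P : B12.RunParams, B15Leaf (WOfRecord₁₃ F N θ lamW P))
    (hUV : ∀ P : B12.RunParams, (genFlow (betaOfRecord₁₃ F N θ) P.g0).InInterval w.γ P.K → ∀ k, k ≤ P.K → SLaw₁₃ F N θ P k →
      ∀ U : GaugeField (F.P P.K) k (SU N),
        chiβOfRecord₁₃ F N θ P.K (gOfRecord₁₃ F N θ P) k U *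
              Real.exp (-(1 / (gOfRecord₁₃ F N θ P k) ^ 2 * wilsonBGOfRecord F N θ.εbg P k U)
                - w.em (gOfRecord₁₃ F N θ P k) * (Fintype.card (Site (F.P P.K) k) : ℝ)) ≤ densOfRecord₁₃ F N θ P k U ∧
        densOfRecord₁₃ F N θ P k U ≤ Real.exp (w.ep (gOfRecord₁₃ F N θ P k) * (Fintype.card (Site (F.P P.K) k) : ℝ)))
    (hlo : BetaLowerH w.b w.γ (datumOfRecord₁₃ F N θ hP).βfun) (hhi : BetaUpperH w.βup w.γ (datumOfRecord₁₃ F N θ hP).βfun) :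
    ∃ (θ' : Stage13Params F N) (h' : θ'.Provisos₁₃ F N), (θ'.ZtUnity F N ∧ θ'.SlotsNondegenerate₁₃ F N) ∧ θ'.Admissible F N ∧
      B16.EndStatementBPrinted (datumOfRecord₁₃ F N θ' h').C ∧
      ∃ γ₁ : ℝ, 0 < γ₁ ∧ ∀ γ : ℝ, 0 < γ → γ ≤ γ₁ → ∃ P : B12.RunParams, 1 ≤ P.K ∧ ((datumOfRecord₁₃ F N θ' h').C P).flow.InInterval γ P.K :=
  ⟨θ, hP, hU, hθ, N24_endStatementBPrinted₁₃_fourPin_pointed θ hP hθ Mstar ops ζ lamW w hC hγ hL hup h05 h06 h07 h08 h09 h09T h10 h11 h12 (fun P k hk => laws₁₃_of_liveSel F N θ P hP hθ hκ hE₀ hB₀ hsel k hk)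
      hUV hlo hhi,
    N24_window_of_betaUpperH _ hγ.1 hhi⟩

/-- **★ ITEM K1‴'s θ-KEYED CONSEQUENT OVER THE FOUR-PIN VIEW WITNESSED BY THE LIVE RE-PIN `(θ.liveRepin₁₃, hP)`** — `SlotsNondegenerate₁₃` (K0a's `slotsNondegenerate₁₃_liveRepin` FROM
`hP`), `ZtUnity` (`ZtUnity.liveRepin₁₃ hZ`), `Admissible` (`Admissible.liveRepin₁₃`), N13's (R₁₃) (`laws₁₃_of_liveSel` at `liveRepin₁₃_ppSel`) DISCHARGED BY NAME; N08 ← THE PRINTED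
`PrintedUV3V N θ.L`; everything else displayed.  COMPOSITE: nothing is discharged as a node.
[cite: Balaban1989LargeFieldII, Thm 1 p.355, (0.1) pp.355–356, p.391; Balaban1988Convergent, p.244, Thm 2 p.263, (3.16)–(3.22) pp.268–269; Balaban1989LargeFieldI, (0.3)–(0.4) p.176; Balaban1987RG1, Thm 3 p.264, (0.17)–(0.21) pp.255–256 and (1.22) p.264; Balaban1985UV3, Thm 1 p.257 (bookkeeping + elementary window)] -/
theorem N24_stabilityBR13e_thetaShape16_fourPin_pointed_liveRepin₁₃ (θ : Stage13Params F N) (hP : (θ.liveRepin₁₃ F N).Provisos₁₃ F N)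
    (hθ : θ.Admissible F N) (hZ : θ.ZtUnity F N) (hκ : 0 ≤ θ.s2.lf.κ) (hE₀ : 0 ≤ θ.s2.lf.E₀) (hB₀ : 0 ≤ θ.s2.lf.B₀)
    (Mstar : ℕ) (ops : OpsY N (θ.liveRepin₁₃ F N).toStage3Params Mstar) (ζ : ResidZ F N) (lamW : ResidW F N) (w : WorldP)
    (hC : w.C = (datumOfRecord₁₃ F N (θ.liveRepin₁₃ F N) hP).C) (hγ : 0 < w.γ ∧ w.γ ≤ (θ.liveRepin₁₃ F N).γ) (hL : w.L = ((θ.liveRepin₁₃ F N).L : ℝ))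
    (hup : ∀ P, w.up P = upOfRecord₅C F N ((θ.liveRepin₁₃ F N).view₁₃B10YZW F N Mstar ops ζ lamW) P)
    (h05 : ∀ P : B12.RunParams,
      B8LeafR ((θ.liveRepin₁₃ F N).res.X P).d8 ((θ.liveRepin₁₃ F N).res.X P).L8 ((θ.liveRepin₁₃ F N).res.X P).C₂ ((θ.liveRepin₁₃ F N).res.X P).B₁' ((θ.liveRepin₁₃ F N).res.X P).B₀' ((θ.liveRepin₁₃ F N).res.X P).B₁ ((θ.liveRepin₁₃ F N).res.X P).B₂ ((θ.liveRepin₁₃ F N).res.X P).c₁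
        ((θ.liveRepin₁₃ F N).res.X P).inp8 ((θ.liveRepin₁₃ F N).res.X P).B₀β ((θ.liveRepin₁₃ F N).res.X P).loc8 ((θ.liveRepin₁₃ F N).res.X P).fam8R ((θ.liveRepin₁₃ F N).res.X P).lan8 ((θ.liveRepin₁₃ F N).res.X P).cub8 ((θ.liveRepin₁₃ F N).res.X P).toAxial8)
    (h06 : B9LeafX (Y9OfRecord N (θ.liveRepin₁₃ F N).toStage3Params Mstar ops))
    (h07 : B11Leaf (Z11OfRecord F N ζ))
    (h08 : PrintedUV3V N (θ.liveRepin₁₃ F N).L)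
    (h09 : ∀ P : B12.RunParams, B12Sec2to5.Lemma4Printed ((θ.liveRepin₁₃ F N).res.X P).F12 ((θ.liveRepin₁₃ F N).res.X P).c12)
    (h09T : ∀ P : B12.RunParams, (leavesP w P).smallCouplings → (leavesP w P).smallFieldInductive)
    (h10 : ∀ P : B12.RunParams, B9LeafX (Y9OfRecord N (θ.liveRepin₁₃ F N).toStage3Params Mstar ops) →
      (B10.Thm1PrintedCompact (((θ.liveRepin₁₃ F N).view₁₃B10YZW F N Mstar ops ζ lamW).res.X P).runs10 ∧
          B10.Thm2Printed (((θ.liveRepin₁₃ F N).view₁₃B10YZW F N Mstar ops ζ lamW).res.X P).runs10) →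
        B11Leaf (Z11OfRecord F N ζ) → B12Sec2to5.Lemma4Printed ((θ.liveRepin₁₃ F N).res.X P).F12 ((θ.liveRepin₁₃ F N).res.X P).c12 →
          B13.Lemma1Printed ((θ.liveRepin₁₃ F N).res.X P).S13 ((θ.liveRepin₁₃ F N).res.X P).c13 ∧ B13.Lemma2Printed ((θ.liveRepin₁₃ F N).res.X P).S13 ((θ.liveRepin₁₃ F N).res.X P).c13 ∧
            B13.Lemma3Printed ((θ.liveRepin₁₃ F N).res.X P).S13 ((θ.liveRepin₁₃ F N).res.X P).c13)
    (h11 : ∀ P : B12.RunParams, (leavesP w P).b7 → (leavesP w P).b8 → (leavesP w P).b9 → (leavesP w P).b10 → (leavesP w P).b11 →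
      (leavesP w P).smallCouplings → (leavesP w P).smallFieldInductive → (leavesP w P).flowControl →
        ∀ k, k < P.K → SLaw₁₃ F N (θ.liveRepin₁₃ F N) P k → TLaw₁₃ F N (θ.liveRepin₁₃ F N) P k)
    (h12 : ∀ P : B12.RunParams, B15Leaf (WOfRecord₁₃ F N (θ.liveRepin₁₃ F N) lamW P))
    (hUV : ∀ P : B12.RunParams, (genFlow (betaOfRecord₁₃ F N (θ.liveRepin₁₃ F N)) P.g0).InInterval w.γ P.K → ∀ k, k ≤ P.K → SLaw₁₃ F N (θ.liveRepin₁₃ F N) P k →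
      ∀ U : GaugeField (F.P P.K) k (SU N),
        chiβOfRecord₁₃ F N (θ.liveRepin₁₃ F N) P.K (gOfRecord₁₃ F N (θ.liveRepin₁₃ F N) P) k U *
              Real.exp (-(1 / (gOfRecord₁₃ F N (θ.liveRepin₁₃ F N) P k) ^ 2 * wilsonBGOfRecord F N (θ.liveRepin₁₃ F N).εbg P k U)
                - w.em (gOfRecord₁₃ F N (θ.liveRepin₁₃ F N) P k) * (Fintype.card (Site (F.P P.K) k) : ℝ)) ≤ densOfRecord₁₃ F N (θ.liveRepin₁₃ F N) P k U ∧
        densOfRecord₁₃ F N (θ.liveRepin₁₃ F N) P k U ≤ Real.exp (w.ep (gOfRecord₁₃ F N (θ.liveRepin₁₃ F N) P k) * (Fintype.card (Site (F.P P.K) k) : ℝ)))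
    (hlo : BetaLowerH w.b w.γ (datumOfRecord₁₃ F N (θ.liveRepin₁₃ F N) hP).βfun) (hhi : BetaUpperH w.βup w.γ (datumOfRecord₁₃ F N (θ.liveRepin₁₃ F N) hP).βfun) :
    ∃ (θ' : Stage13Params F N) (h' : θ'.Provisos₁₃ F N), (θ'.ZtUnity F N ∧ θ'.SlotsNondegenerate₁₃ F N) ∧ θ'.Admissible F N ∧
      B16.EndStatementBPrinted (datumOfRecord₁₃ F N θ' h').C ∧
      ∃ γ₁ : ℝ, 0 < γ₁ ∧ ∀ γ : ℝ, 0 < γ → γ ≤ γ₁ → ∃ P : B12.RunParams, 1 ≤ P.K ∧ ((datumOfRecord₁₃ F N θ' h').C P).flow.InInterval γ P.K :=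
  ⟨θ.liveRepin₁₃ F N, hP, ⟨Stage13Params.ZtUnity.liveRepin₁₃ hZ, Stage13Params.slotsNondegenerate₁₃_liveRepin F N θ hP⟩, Stage13Params.Admissible.liveRepin₁₃ hθ,
    N24_endStatementBPrinted₁₃_fourPin_pointed (θ.liveRepin₁₃ F N) hP (Stage13Params.Admissible.liveRepin₁₃ hθ) Mstar ops ζ lamW w hC hγ hL hup h05 h06 h07 h08 h09 h09T
      h10 h11 h12 (fun P k hk => laws₁₃_of_liveSel F N (θ.liveRepin₁₃ F N) P hP (Stage13Params.Admissible.liveRepin₁₃ hθ) hκ hE₀ hB₀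
        (Stage13Params.liveRepin₁₃_ppSel F N θ) k hk) hUV hlo hhi,
    N24_window_of_betaUpperH _ hγ.1 hhi⟩

/-! ## §3. The rung body `BetaWindowAtSomeRecord13` on the live re-pin (unpinned view and four-pin view) -/

/-- **THE BODY OF `BetaWindowAtSomeRecord13` WITNESSED BY `(θ.liveRepin₁₃, hP, w)` AT THE UNPINNED STAGE-13 VIEW** — guard, admissibility and N13's (R₁₃) discharged by name as
in §2; THE HYPOTHESIS LIST IS «WHICH CHILD BLOCKS `stub_betaWindow13` ON THE LIVE LINE». [cite: Balaban1989LargeFieldII, Thm 1 p.355, (0.1) pp.355–356, p.391; Balaban1988Convergent, p.244, Thm 2 p.263; Balaban1987RG1, Thm 3 p.264, (0.17)–(0.21) pp.255–256 and (1.22) p.264 (bookkeeping + elementary window)] -/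
theorem N24_betaWindowAtSomeRecord₁₃_of_pointed_liveRepin₁₃_of_boxH (θ : Stage13Params F N) (hP : (θ.liveRepin₁₃ F N).Provisos₁₃ F N)
    (hθ : θ.Admissible F N) (hZ : θ.ZtUnity F N) (hκ : 0 ≤ θ.s2.lf.κ) (hE₀ : 0 ≤ θ.s2.lf.E₀) (hB₀ : 0 ≤ θ.s2.lf.B₀)
    (w : WorldP)
    (hC : w.C = (datumOfRecord₁₃ F N (θ.liveRepin₁₃ F N) hP).C) (hγ : 0 < w.γ ∧ w.γ ≤ (θ.liveRepin₁₃ F N).γ) (hL : w.L = ((θ.liveRepin₁₃ F N).L : ℝ))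
    (hup : ∀ P, w.up P = upOfRecord₅C F N ((θ.liveRepin₁₃ F N).toStage5₁₃ F N) P)
    (h05 : ∀ P : B12.RunParams,
      B8LeafR ((θ.liveRepin₁₃ F N).res.X P).d8 ((θ.liveRepin₁₃ F N).res.X P).L8 ((θ.liveRepin₁₃ F N).res.X P).C₂ ((θ.liveRepin₁₃ F N).res.X P).B₁' ((θ.liveRepin₁₃ F N).res.X P).B₀' ((θ.liveRepin₁₃ F N).res.X P).B₁ ((θ.liveRepin₁₃ F N).res.X P).B₂ ((θ.liveRepin₁₃ F N).res.X P).c₁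
        ((θ.liveRepin₁₃ F N).res.X P).inp8 ((θ.liveRepin₁₃ F N).res.X P).B₀β ((θ.liveRepin₁₃ F N).res.X P).loc8 ((θ.liveRepin₁₃ F N).res.X P).fam8R ((θ.liveRepin₁₃ F N).res.X P).lan8 ((θ.liveRepin₁₃ F N).res.X P).cub8 ((θ.liveRepin₁₃ F N).res.X P).toAxial8)
    (h06 : ∀ P : B12.RunParams, B9LeafX ((θ.liveRepin₁₃ F N).res.Y P))
    (h07 : ∀ P : B12.RunParams, B11Leaf ((θ.liveRepin₁₃ F N).res.Z P))
    (h08 : ∀ P : B12.RunParams, ∃ (Xc : PrintedCarriersR) (I : Type) (C : B10Assembly.Consts) (T : I → B10.TowerRun),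
      Nonempty (∀ i, B10Assembly.LeafSystem C (T i)) ∧ (θ.liveRepin₁₃ F N).res.X P = Xc.withTowerRuns10 T)
    (h09 : ∀ P : B12.RunParams, B12Sec2to5.Lemma4Printed ((θ.liveRepin₁₃ F N).res.X P).F12 ((θ.liveRepin₁₃ F N).res.X P).c12)
    (h09T : ∀ P : B12.RunParams, (leavesP w P).smallCouplings → (leavesP w P).smallFieldInductive)
    (h10 : ∀ P : B12.RunParams, B9LeafX ((θ.liveRepin₁₃ F N).res.Y P) →
      (B10.Thm1PrintedCompact ((θ.liveRepin₁₃ F N).res.X P).runs10 ∧ B10.Thm2Printed ((θ.liveRepin₁₃ F N).res.X P).runs10) →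
        B11Leaf ((θ.liveRepin₁₃ F N).res.Z P) → B12Sec2to5.Lemma4Printed ((θ.liveRepin₁₃ F N).res.X P).F12 ((θ.liveRepin₁₃ F N).res.X P).c12 →
          B13.Lemma1Printed ((θ.liveRepin₁₃ F N).res.X P).S13 ((θ.liveRepin₁₃ F N).res.X P).c13 ∧ B13.Lemma2Printed ((θ.liveRepin₁₃ F N).res.X P).S13 ((θ.liveRepin₁₃ F N).res.X P).c13 ∧
            B13.Lemma3Printed ((θ.liveRepin₁₃ F N).res.X P).S13 ((θ.liveRepin₁₃ F N).res.X P).c13)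
    (h11 : ∀ P : B12.RunParams, (leavesP w P).b7 → (leavesP w P).b8 → (leavesP w P).b9 → (leavesP w P).b10 → (leavesP w P).b11 →
      (leavesP w P).smallCouplings → (leavesP w P).smallFieldInductive → (leavesP w P).flowControl →
        ∀ k, k < P.K → SLaw₁₃ F N (θ.liveRepin₁₃ F N) P k → TLaw₁₃ F N (θ.liveRepin₁₃ F N) P k)
    (h12 : ∀ P : B12.RunParams, B15Leaf ((θ.liveRepin₁₃ F N).res.W P))
    (hUV : ∀ P : B12.RunParams, (genFlow (betaOfRecord₁₃ F N (θ.liveRepin₁₃ F N)) P.g0).InInterval w.γ P.K → ∀ k, k ≤ P.K → SLaw₁₃ F N (θ.liveRepin₁₃ F N) P k →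
      ∀ U : GaugeField (F.P P.K) k (SU N),
        chiβOfRecord₁₃ F N (θ.liveRepin₁₃ F N) P.K (gOfRecord₁₃ F N (θ.liveRepin₁₃ F N) P) k U *
              Real.exp (-(1 / (gOfRecord₁₃ F N (θ.liveRepin₁₃ F N) P k) ^ 2 * wilsonBGOfRecord F N (θ.liveRepin₁₃ F N).εbg P k U)
                - w.em (gOfRecord₁₃ F N (θ.liveRepin₁₃ F N) P k) * (Fintype.card (Site (F.P P.K) k) : ℝ)) ≤ densOfRecord₁₃ F N (θ.liveRepin₁₃ F N) P k U ∧
        densOfRecord₁₃ F N (θ.liveRepin₁₃ F N) P k U ≤ Real.exp (w.ep (gOfRecord₁₃ F N (θ.liveRepin₁₃ F N) P k) * (Fintype.card (Site (F.P P.K) k) : ℝ)))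
    (hlo : BetaLowerH w.b w.γ (datumOfRecord₁₃ F N (θ.liveRepin₁₃ F N) hP).βfun) (hhi : BetaUpperH w.βup w.γ (datumOfRecord₁₃ F N (θ.liveRepin₁₃ F N) hP).βfun) :
    ∃ (θ' : Stage13Params F N) (h' : θ'.Provisos₁₃ F N) (w' : WorldP), (θ'.ZtUnity F N ∧ θ'.SlotsNondegenerate₁₃ F N) ∧ θ'.Admissible F N ∧
      IsRecordOfRecord₁₃C F N (datumOfRecord₁₃ F N θ' h') w' ∧ (∀ P : B12.RunParams, Nodes (leavesP w' P)) ∧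
      BetaBoundsInInterval w'.C.toB12 w'.γ w'.b w'.βup ∧
      ∃ γ₁ : ℝ, 0 < γ₁ ∧ ∀ γ : ℝ, 0 < γ → γ ≤ γ₁ → ∃ P : B12.RunParams, 1 ≤ P.K ∧ ((datumOfRecord₁₃ F N θ' h').C P).flow.InInterval γ P.K :=
  N24_betaWindowAtSomeRecord₁₃_of_pointed_of_boxH (θ.liveRepin₁₃ F N) hP (Stage13Params.Admissible.liveRepin₁₃ hθ)
    ⟨Stage13Params.ZtUnity.liveRepin₁₃ hZ, Stage13Params.slotsNondegenerate₁₃_liveRepin F N θ hP⟩ w hC hγ hL hup h05 h06 h07 h08 h09 h09T h10 h11 h12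
    (fun P k hk => laws₁₃_of_liveSel F N (θ.liveRepin₁₃ F N) P hP (Stage13Params.Admissible.liveRepin₁₃ hθ) hκ hE₀ hB₀
      (Stage13Params.liveRepin₁₃_ppSel F N θ) k hk) hUV hlo hhi

/-- **THE BODY OF `BetaWindowAtSomeRecord13` WITNESSED BY `(θ.liveRepin₁₃, hP, w)` OVER THE FOUR-PIN VIEW** (N08 ← the printed `PrintedUV3V N θ.L`; N06 ∕ N07 ∕ N12 at the chosen
layers) — guard, admissibility and N13's (R₁₃) discharged by name. [cite: Balaban1989LargeFieldII, Thm 1 p.355, (0.1) pp.355–356, p.391; Balaban1988Convergent, p.244, Thm 2 p.263; Balaban1987RG1, Thm 3 p.264, (0.17)–(0.21) pp.255–256 and (1.22) p.264; Balaban1985UV3, Thm 1 p.257 (bookkeeping + elementary window)] -/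
theorem N24_betaWindowAtSomeRecord₁₃_of_fourPin_pointed_liveRepin₁₃_of_boxH (θ : Stage13Params F N) (hP : (θ.liveRepin₁₃ F N).Provisos₁₃ F N)
    (hθ : θ.Admissible F N) (hZ : θ.ZtUnity F N) (hκ : 0 ≤ θ.s2.lf.κ) (hE₀ : 0 ≤ θ.s2.lf.E₀) (hB₀ : 0 ≤ θ.s2.lf.B₀)
    (Mstar : ℕ) (ops : OpsY N (θ.liveRepin₁₃ F N).toStage3Params Mstar) (ζ : ResidZ F N) (lamW : ResidW F N) (w : WorldP)
    (hC : w.C = (datumOfRecord₁₃ F N (θ.liveRepin₁₃ F N) hP).C) (hγ : 0 < w.γ ∧ w.γ ≤ (θ.liveRepin₁₃ F N).γ) (hL : w.L = ((θ.liveRepin₁₃ F N).L : ℝ))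
    (hup : ∀ P, w.up P = upOfRecord₅C F N ((θ.liveRepin₁₃ F N).view₁₃B10YZW F N Mstar ops ζ lamW) P)
    (h05 : ∀ P : B12.RunParams,
      B8LeafR ((θ.liveRepin₁₃ F N).res.X P).d8 ((θ.liveRepin₁₃ F N).res.X P).L8 ((θ.liveRepin₁₃ F N).res.X P).C₂ ((θ.liveRepin₁₃ F N).res.X P).B₁' ((θ.liveRepin₁₃ F N).res.X P).B₀' ((θ.liveRepin₁₃ F N).res.X P).B₁ ((θ.liveRepin₁₃ F N).res.X P).B₂ ((θ.liveRepin₁₃ F N).res.X P).c₁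
        ((θ.liveRepin₁₃ F N).res.X P).inp8 ((θ.liveRepin₁₃ F N).res.X P).B₀β ((θ.liveRepin₁₃ F N).res.X P).loc8 ((θ.liveRepin₁₃ F N).res.X P).fam8R ((θ.liveRepin₁₃ F N).res.X P).lan8 ((θ.liveRepin₁₃ F N).res.X P).cub8 ((θ.liveRepin₁₃ F N).res.X P).toAxial8)
    (h06 : B9LeafX (Y9OfRecord N (θ.liveRepin₁₃ F N).toStage3Params Mstar ops))
    (h07 : B11Leaf (Z11OfRecord F N ζ))
    (h08 : PrintedUV3V N (θ.liveRepin₁₃ F N).L)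
    (h09 : ∀ P : B12.RunParams, B12Sec2to5.Lemma4Printed ((θ.liveRepin₁₃ F N).res.X P).F12 ((θ.liveRepin₁₃ F N).res.X P).c12)
    (h09T : ∀ P : B12.RunParams, (leavesP w P).smallCouplings → (leavesP w P).smallFieldInductive)
    (h10 : ∀ P : B12.RunParams, B9LeafX (Y9OfRecord N (θ.liveRepin₁₃ F N).toStage3Params Mstar ops) →
      (B10.Thm1PrintedCompact (((θ.liveRepin₁₃ F N).view₁₃B10YZW F N Mstar ops ζ lamW).res.X P).runs10 ∧
          B10.Thm2Printed (((θ.liveRepin₁₃ F N).view₁₃B10YZW F N Mstar ops ζ lamW).res.X P).runs10) →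
        B11Leaf (Z11OfRecord F N ζ) → B12Sec2to5.Lemma4Printed ((θ.liveRepin₁₃ F N).res.X P).F12 ((θ.liveRepin₁₃ F N).res.X P).c12 →
          B13.Lemma1Printed ((θ.liveRepin₁₃ F N).res.X P).S13 ((θ.liveRepin₁₃ F N).res.X P).c13 ∧ B13.Lemma2Printed ((θ.liveRepin₁₃ F N).res.X P).S13 ((θ.liveRepin₁₃ F N).res.X P).c13 ∧
            B13.Lemma3Printed ((θ.liveRepin₁₃ F N).res.X P).S13 ((θ.liveRepin₁₃ F N).res.X P).c13)
    (h11 : ∀ P : B12.RunParams, (leavesP w P).b7 → (leavesP w P).b8 → (leavesP w P).b9 → (leavesP w P).b10 → (leavesP w P).b11 →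
      (leavesP w P).smallCouplings → (leavesP w P).smallFieldInductive → (leavesP w P).flowControl →
        ∀ k, k < P.K → SLaw₁₃ F N (θ.liveRepin₁₃ F N) P k → TLaw₁₃ F N (θ.liveRepin₁₃ F N) P k)
    (h12 : ∀ P : B12.RunParams, B15Leaf (WOfRecord₁₃ F N (θ.liveRepin₁₃ F N) lamW P))
    (hUV : ∀ P : B12.RunParams, (genFlow (betaOfRecord₁₃ F N (θ.liveRepin₁₃ F N)) P.g0).InInterval w.γ P.K → ∀ k, k ≤ P.K → SLaw₁₃ F N (θ.liveRepin₁₃ F N) P k →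
      ∀ U : GaugeField (F.P P.K) k (SU N),
        chiβOfRecord₁₃ F N (θ.liveRepin₁₃ F N) P.K (gOfRecord₁₃ F N (θ.liveRepin₁₃ F N) P) k U *
              Real.exp (-(1 / (gOfRecord₁₃ F N (θ.liveRepin₁₃ F N) P k) ^ 2 * wilsonBGOfRecord F N (θ.liveRepin₁₃ F N).εbg P k U)
                - w.em (gOfRecord₁₃ F N (θ.liveRepin₁₃ F N) P k) * (Fintype.card (Site (F.P P.K) k) : ℝ)) ≤ densOfRecord₁₃ F N (θ.liveRepin₁₃ F N) P k U ∧
        densOfRecord₁₃ F N (θ.liveRepin₁₃ F N) P k U ≤ Real.exp (w.ep (gOfRecord₁₃ F N (θ.liveRepin₁₃ F N) P k) * (Fintype.card (Site (F.P P.K) k) : ℝ)))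
    (hlo : BetaLowerH w.b w.γ (datumOfRecord₁₃ F N (θ.liveRepin₁₃ F N) hP).βfun) (hhi : BetaUpperH w.βup w.γ (datumOfRecord₁₃ F N (θ.liveRepin₁₃ F N) hP).βfun) :
    ∃ (θ' : Stage13Params F N) (h' : θ'.Provisos₁₃ F N) (w' : WorldP), (θ'.ZtUnity F N ∧ θ'.SlotsNondegenerate₁₃ F N) ∧ θ'.Admissible F N ∧
      IsRecordOfRecord₁₃C F N (datumOfRecord₁₃ F N θ' h') w' ∧ (∀ P : B12.RunParams, Nodes (leavesP w' P)) ∧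
      BetaBoundsInInterval w'.C.toB12 w'.γ w'.b w'.βup ∧
      ∃ γ₁ : ℝ, 0 < γ₁ ∧ ∀ γ : ℝ, 0 < γ → γ ≤ γ₁ → ∃ P : B12.RunParams, 1 ≤ P.K ∧ ((datumOfRecord₁₃ F N θ' h').C P).flow.InInterval γ P.K :=
  N24_betaWindowAtSomeRecord₁₃_of_fourPin_pointed_of_boxH (θ.liveRepin₁₃ F N) hP (Stage13Params.Admissible.liveRepin₁₃ hθ)
    ⟨Stage13Params.ZtUnity.liveRepin₁₃ hZ, Stage13Params.slotsNondegenerate₁₃_liveRepin F N θ hP⟩ Mstar ops ζ lamW w hC hγ hL hup h05 h06 h07 h08 h09 h09T h10 h11 h12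
    (fun P k hk => laws₁₃_of_liveSel F N (θ.liveRepin₁₃ F N) P hP (Stage13Params.Admissible.liveRepin₁₃ hθ) hκ hE₀ hB₀
      (Stage13Params.liveRepin₁₃_ppSel F N θ) k hk) hUV hlo hhi

end Literature.MathematicalPhysics.QuantumFieldTheory.Balaban1983to89.Node00

end
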